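import Summits.Ventures.PercRepro0.Invariance
import Summits.Ventures.PercRepro0.Crossing

/-!
# The planar dual map on configurations and its law (seat p1, gen 1)

Lean twin, on the cell's `Defs.lean`, of P8 · SELF-DUAL Theorem 2.1 / Lemma 2.3 composed with the
identification `ψ` of P6-dualcrossing-p1-v1 §4 (`ψ(x,y) = (y+½, x−½)`), OFF the declaration path
(lead 23:00:52Z). Instead of the dual lattice `(ℤ+½)²` we work with the composite edge map
`τ = ψ̂ ∘ (·)*` on the bonds of `ℤ²` themselves:

* `τ` sends the horizontal bond `{(i,j),(i+1,j)}` to `{(j,i),(j+1,i)}` and the vertical bond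
  `{(i,j),(i,j+1)}` to `{(j+1,i−1),(j+1,i)}` (P6 Lemma 4.2(c), computed on the edge types of Lemma 1.1);
  it is an involution of the bond set (`dualEdge_dualEdge`, `dualEdge_mem_bonds`), extended by the
  identity to non-bonds so as to be a bijection `dualEquiv` of `Sym2 (Vertex 2)`;
* the dual configuration `dualConfig ω = {e : τ e ∈ 𝔼² ∖ ω}` — a bond `e` is open in `dualConfig ω` iff
  the bond `τ e` is closed in `ω` (this is `ω*(e*) = 1 − ω(e)` transported along `ψ`);
* `setBernoulli_map_diff`: the complement `ω ↦ u ∖ ω` carries `setBer(u, p)` to `setBer(u, 1−p)`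
  (coordinatewise through Mathlib's `infinitePi_map_pi`);
* `P_map_dualConfig`: `(P_p).map dualConfig = P_{1−p}` (P8 Theorem 2.1 + Lemma 2.3), hence at `p = ½`
  `P_½(dualConfig⁻¹ A) = P_½(A)` for every measurable `A` (`P_half_preimage_dualConfig`).

Imports only landed PercRepro0 modules (which import Mathlib). No instances, no notation, no axioms.
-/

namespace Summit.Ventures.PercRepro0.DualMap

open Summit.Ventures.PercRepro0.Defs Summit.Ventures.PercRepro0.Crossing
open MeasureTheory ProbabilityTheory unitInterval Set
open scoped ENNReal

/-! ## Bonds of `ℤ²`: the two types -/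

/-- Adjacency in `𝕃²`, in coordinates. -/
theorem lattice_adj_iff (x y : Vertex 2) :
    (lattice 2).Adj x y ↔ |x 0 - y 0| + |x 1 - y 1| = 1 := by
  show (∑ i, |x i - y i|) = 1 ↔ _
  rw [Fin.sum_univ_two]

/-- A pair is a bond iff it is a horizontal or a vertical unit step. -/
theorem mem_bonds_iff (x y : Vertex 2) :
    s(x, y) ∈ bonds 2 ↔ (x 1 = y 1 ∧ |x 0 - y 0| = 1) ∨ (x 0 = y 0 ∧ |x 1 - y 1| = 1) := by
  rw [bonds, SimpleGraph.mem_edgeSet, lattice_adj_iff]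
  constructor
  · intro h
    rcases abs_cases (x 0 - y 0) with ⟨h0, _⟩ | ⟨h0, _⟩ <;>
    rcases abs_cases (x 1 - y 1) with ⟨h1, _⟩ | ⟨h1, _⟩ <;>
    · rw [h0, h1] at h
      by_cases hx : x 1 = y 1
      · left; exact ⟨hx, by rw [h0]; omega⟩
      · right
        refine ⟨?_, by rw [h1]; omega⟩
        have : |x 1 - y 1| ≠ 0 := by rw [abs_ne_zero]; omega
        rw [h1] at this
        omega
  · rintro (⟨h1, h0⟩ | ⟨h0, h1⟩)
    · rw [h0, h1, sub_self, abs_zero, add_zero]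
    · rw [h0, h1, sub_self, abs_zero, zero_add]

/-- The horizontal bond `{(i,j),(i+1,j)}` is a bond. -/
theorem h_mem_bonds (i j : ℤ) : s(pt i j, pt (i + 1) j) ∈ bonds 2 := by
  rw [mem_bonds_iff]
  left
  simp

/-- The vertical bond `{(i,j),(i,j+1)}` is a bond. -/
theorem v_mem_bonds (i j : ℤ) : s(pt i j, pt i (j + 1)) ∈ bonds 2 := by
  rw [mem_bonds_iff]
  right
  simp

/-- A vertex with prescribed coordinates is the corresponding `pt`. -/
theorem eq_pt_of {x : Vertex 2} {a b : ℤ} (ha : x 0 = a) (hb : x 1 = b) : x = pt a b := by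
  rw [eq_pt x, ha, hb]

/-- Every bond is a horizontal bond `{(i,j),(i+1,j)}` or a vertical bond `{(i,j),(i,j+1)}`. -/
theorem bond_cases (e : Sym2 (Vertex 2)) (he : e ∈ bonds 2) :
    ∃ i j : ℤ, e = s(pt i j, pt (i + 1) j) ∨ e = s(pt i j, pt i (j + 1)) := by
  induction e using Sym2.ind with
  | h x y =>
    rw [mem_bonds_iff] at he
    rcases he with ⟨h1, h0⟩ | ⟨h0, h1⟩
    · rcases abs_eq (zero_le_one' ℤ) |>.1 h0 with h | h
      · -- x 0 = y 0 + 1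
        refine ⟨y 0, y 1, Or.inl ?_⟩
        rw [Sym2.eq_swap]
        congr 1
        · exact eq_pt_of rfl rfl
        · exact eq_pt_of (by omega) (by omega)
      · refine ⟨x 0, x 1, Or.inl ?_⟩
        congr 1
        · exact eq_pt_of rfl rfl
        · exact eq_pt_of (by omega) (by omega)
    · rcases abs_eq (zero_le_one' ℤ) |>.1 h1 with h | h
      · refine ⟨y 0, y 1, Or.inr ?_⟩
        rw [Sym2.eq_swap]
        congr 1
        · exact eq_pt_of rfl rfl
        · exact eq_pt_of (by omega) (by omega)
      · refine ⟨x 0, x 1, Or.inr ?_⟩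
        congr 1
        · exact eq_pt_of rfl rfl
        · exact eq_pt_of (by omega) (by omega)

/-! ## The edge map `τ` -/

/-- The edge map on ordered pairs: a horizontal pair `{(a,j),(b,j)}` goes to `{(j,m),(j+1,m)}` and a
vertical pair `{(i,a),(i,b)}` to `{(m+1,i−1),(m+1,i)}`, `m` the smaller of `a, b`; other pairs are fixed. -/
def dualPair (x y : Vertex 2) : Sym2 (Vertex 2) :=
  if x 1 = y 1 then s(pt (x 1) (min (x 0) (y 0)), pt (x 1 + 1) (min (x 0) (y 0)))
  else if x 0 = y 0 then s(pt (min (x 1) (y 1) + 1) (x 0 - 1), pt (min (x 1) (y 1) + 1) (x 0))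
  else s(x, y)

/-- `dualPair` is symmetric. -/
theorem dualPair_comm (x y : Vertex 2) : dualPair x y = dualPair y x := by
  unfold dualPair
  by_cases h1 : x 1 = y 1
  · rw [if_pos h1, if_pos h1.symm, h1, min_comm]
  · rw [if_neg h1, if_neg (Ne.symm h1)]
    by_cases h0 : x 0 = y 0
    · rw [if_pos h0, if_pos h0.symm, h0, min_comm]
    · rw [if_neg h0, if_neg (Ne.symm h0), Sym2.eq_swap]

/-- The edge map `τ₀` on unordered pairs. -/
def dualEdge0 (e : Sym2 (Vertex 2)) : Sym2 (Vertex 2) := Sym2.lift ⟨dualPair, dualPair_comm⟩ e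

/-- `τ₀` on a pair. -/
theorem dualEdge0_mk (x y : Vertex 2) : dualEdge0 s(x, y) = dualPair x y := rfl

/-- `τ₀` on a horizontal bond: `{(i,j),(i+1,j)} ↦ {(j,i),(j+1,i)}` (P6 Lemma 4.2(c), type (v)). -/
theorem dualEdge0_h (i j : ℤ) : dualEdge0 s(pt i j, pt (i + 1) j) = s(pt j i, pt (j + 1) i) := by
  rw [dualEdge0_mk, dualPair]
  simp only [pt_zero, pt_one, min_eq_left (show i ≤ i + 1 by omega), if_true]

/-- `τ₀` on a vertical bond: `{(i,j),(i,j+1)} ↦ {(j+1,i−1),(j+1,i)}` (P6 Lemma 4.2(c), type (h)). -/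
theorem dualEdge0_v (i j : ℤ) :
    dualEdge0 s(pt i j, pt i (j + 1)) = s(pt (j + 1) (i - 1), pt (j + 1) i) := by
  rw [dualEdge0_mk, dualPair]
  have hne : ¬ (j = j + 1) := by omega
  simp only [pt_zero, pt_one, hne, if_false, if_true, min_eq_left (show j ≤ j + 1 by omega)]

open scoped Classical in
/-- The edge map `τ = ψ̂ ∘ (·)*` on bonds, extended by the identity to non-bonds. -/
noncomputable def dualEdge (e : Sym2 (Vertex 2)) : Sym2 (Vertex 2) :=
  if e ∈ bonds 2 then dualEdge0 e else e

/-- `τ` on a bond is `τ₀`. -/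
theorem dualEdge_of_mem {e : Sym2 (Vertex 2)} (he : e ∈ bonds 2) : dualEdge e = dualEdge0 e := by
  rw [dualEdge, if_pos he]

/-- `τ` fixes non-bonds. -/
theorem dualEdge_of_notMem {e : Sym2 (Vertex 2)} (he : e ∉ bonds 2) : dualEdge e = e := by
  rw [dualEdge, if_neg he]

/-- `τ` on a horizontal bond. -/
theorem dualEdge_h (i j : ℤ) : dualEdge s(pt i j, pt (i + 1) j) = s(pt j i, pt (j + 1) i) := by
  rw [dualEdge_of_mem (h_mem_bonds i j), dualEdge0_h]

/-- `τ` on a vertical bond. -/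
theorem dualEdge_v (i j : ℤ) :
    dualEdge s(pt i j, pt i (j + 1)) = s(pt (j + 1) (i - 1), pt (j + 1) i) := by
  rw [dualEdge_of_mem (v_mem_bonds i j), dualEdge0_v]

/-- `τ` maps bonds to bonds. -/
theorem dualEdge_mem_bonds_of_mem {e : Sym2 (Vertex 2)} (he : e ∈ bonds 2) : dualEdge e ∈ bonds 2 := by
  obtain ⟨i, j, h | h⟩ := bond_cases e he
  · rw [h, dualEdge_h]; exact h_mem_bonds j i
  · rw [h, dualEdge_v]
    have := v_mem_bonds (j + 1) (i - 1)
    rwa [sub_add_cancel] at this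

/-- `τ ∘ τ = id`. -/
theorem dualEdge_dualEdge (e : Sym2 (Vertex 2)) : dualEdge (dualEdge e) = e := by
  by_cases he : e ∈ bonds 2
  · obtain ⟨i, j, h | h⟩ := bond_cases e he
    · rw [h, dualEdge_h, dualEdge_h]
    · rw [h, dualEdge_v]
      have := dualEdge_v (j + 1) (i - 1)
      rw [sub_add_cancel] at this
      rw [this, add_sub_cancel_right]
  · rw [dualEdge_of_notMem he, dualEdge_of_notMem he]

/-- `τ` preserves the bond set. -/
theorem dualEdge_mem_bonds (e : Sym2 (Vertex 2)) : dualEdge e ∈ bonds 2 ↔ e ∈ bonds 2 := by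
  constructor
  · intro h
    by_contra he
    rw [dualEdge_of_notMem he] at h
    exact he h
  · exact dualEdge_mem_bonds_of_mem

/-- `τ` as a bijection of `Sym2 (Vertex 2)` (an involution). -/
noncomputable def dualEquiv : Sym2 (Vertex 2) ≃ Sym2 (Vertex 2) where
  toFun := dualEdge
  invFun := dualEdge
  left_inv := dualEdge_dualEdge
  right_inv := dualEdge_dualEdge

/-- `dualEquiv` acts as `τ`. -/
theorem dualEquiv_apply (e : Sym2 (Vertex 2)) : dualEquiv e = dualEdge e := rfl

/-! ## The dual configuration -/

/-- The dual configuration `ω ↦ relabel τ (𝔼² ∖ ω)`: a bond `e` is open in `dualConfig ω` iff the bond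
`τ e` is closed in `ω` (the convention `ω*(e*) = 1 − ω(e)` of ROUTE-v3 §0, transported along `ψ`). -/
def dualConfig (ω : Config 2) : Config 2 := relabel dualEquiv (bonds 2 \ ω)

/-- Membership in the dual configuration. -/
theorem mem_dualConfig (ω : Config 2) (e : Sym2 (Vertex 2)) :
    e ∈ dualConfig ω ↔ dualEdge e ∈ bonds 2 ∧ dualEdge e ∉ ω := Iff.rfl

/-- For a bond `e`: `e` is open in `dualConfig ω` iff `τ e` is closed in `ω`. -/
theorem mem_dualConfig_iff_of_mem (ω : Config 2) {e : Sym2 (Vertex 2)} (he : e ∈ bonds 2) :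
    e ∈ dualConfig ω ↔ dualEdge e ∉ ω := by
  rw [mem_dualConfig]
  exact ⟨fun h => h.2, fun h => ⟨dualEdge_mem_bonds_of_mem he, h⟩⟩

/-- The complement map `ω ↦ u ∖ ω` is measurable. -/
theorem measurable_diff {ι : Type*} (u : Set ι) : Measurable (fun ω : Set ι => u \ ω) := by
  rw [measurable_set_iff]
  intro a
  have : (fun ω : Set ι => a ∈ u \ ω) = (fun q : Prop => a ∈ u ∧ ¬ q) ∘ (fun ω : Set ι => a ∈ ω) := by
    funext ω; rfl
  rw [this]
  exact Measurable.of_discrete.comp (measurable_set_mem a)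

/-- `dualConfig` is measurable. -/
theorem measurable_dualConfig : Measurable dualConfig :=
  (measurable_relabel dualEquiv).comp (measurable_diff (bonds 2))

/-! ## The law of the dual configuration -/

/-- The complement `ω ↦ u ∖ ω` carries `setBer(u, p)` to `setBer(u, 1−p)`: coordinatewise, the map
`q ↦ (i ∈ u ∧ ¬q)` exchanges the two atoms of the Bernoulli law of every coordinate in `u` and fixes the
point mass at `False` of the coordinates outside `u`. -/
theorem setBernoulli_map_diff {ι : Type*} (u : Set ι) (p : I) :
    (setBernoulli u p).map (fun ω : Set ι => u \ ω) = setBernoulli u (σ p) := by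
  have hcomp : (fun ω : Set ι => u \ ω) ∘ (fun P : ι → Prop => {i | P i})
      = (fun P : ι → Prop => {i | P i}) ∘ (fun (P : ι → Prop) (i : ι) => i ∈ u ∧ ¬ P i) := by
    funext P
    ext i
    simp only [Function.comp_apply, Set.mem_sdiff, Set.mem_setOf_eq]
  have hg : Measurable (fun (P : ι → Prop) (i : ι) => i ∈ u ∧ ¬ P i) := by
    refine measurable_pi_lambda _ fun i => ?_
    show Measurable ((fun q : Prop => i ∈ u ∧ ¬ q) ∘ (fun P : ι → Prop => P i))
    exact Measurable.of_discrete.comp (measurable_pi_apply i)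
  rw [setBernoulli_eq_map, setBernoulli_eq_map, Measure.map_map (measurable_diff u) measurable_setOf,
    hcomp, ← Measure.map_map measurable_setOf hg]
  congr 1
  have h := Measure.infinitePi_map_pi
    (fun i : ι => toNNReal p • Measure.dirac (i ∈ u) + toNNReal (σ p) • Measure.dirac False)
    (f := fun (i : ι) (q : Prop) => i ∈ u ∧ ¬ q) (fun _ => Measurable.of_discrete)
  refine h.trans ?_
  congr 1
  funext i
  rw [Measure.map_add _ _ Measurable.of_discrete, Measure.map_smul, Measure.map_smul, Measure.map_dirac,
    Measure.map_dirac]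
  have h1 : ((i ∈ u ∧ ¬ (i ∈ u)) : Prop) = False := propext ⟨fun h => h.2 h.1, fun h => h.elim⟩
  have h2 : ((i ∈ u ∧ ¬ False) : Prop) = (i ∈ u) := propext ⟨fun h => h.1, fun h => ⟨h, not_false⟩⟩
  rw [h1, h2, unitInterval.symm_symm, add_comm]

/-- **The law of the dual configuration** (P8 Theorem 2.1 + Lemma 2.3): `(P_p).map dualConfig = P_{1−p}`. -/
theorem P_map_dualConfig (p : I) : (P 2 p).map dualConfig = P 2 (σ p) := by
  have h : dualConfig = relabel dualEquiv ∘ (fun ω : Config 2 => bonds 2 \ ω) := by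
    funext ω; rfl
  rw [h, ← Measure.map_map (measurable_relabel dualEquiv) (measurable_diff (bonds 2))]
  show ((setBernoulli (bonds 2) p).map _).map _ = setBernoulli (bonds 2) (σ p)
  rw [setBernoulli_map_diff]
  exact setBernoulli_map_relabel (bonds 2) (σ p) dualEquiv dualEdge_mem_bonds

/-- `½` is its own reflection `1 − ½`. -/
theorem symm_clamp_half : σ (clamp (1 / 2)) = clamp (1 / 2) := by
  apply Subtype.ext
  rw [unitInterval.coe_symm_eq, Summit.Ventures.PercRepro0.PlanarT2.coe_clamp_half]
  norm_num

/-- At `p = ½` the dual configuration has the law of the configuration (P8 Theorem 2.1 at `p = ½`). -/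
theorem P_half_map_dualConfig : (P 2 (clamp (1 / 2))).map dualConfig = P 2 (clamp (1 / 2)) := by
  rw [P_map_dualConfig, symm_clamp_half]

/-- At `p = ½`: `P_½(dualConfig⁻¹ A) = P_½(A)` for every measurable event `A`. -/
theorem P_half_preimage_dualConfig {A : Set (Config 2)} (hA : MeasurableSet A) :
    P 2 (clamp (1 / 2)) (dualConfig ⁻¹' A) = P 2 (clamp (1 / 2)) A := by
  rw [← Measure.map_apply measurable_dualConfig hA, P_half_map_dualConfig]

end Summit.Ventures.PercRepro0.DualMap
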